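import Literature.Computability.QuantumComplexity.GuessedOracleRuns
import Literature.Computability.QuantumComplexity.OracleReadCounting
import Literature.Computability.QuantumComplexity.AaronsonAmbainisThm23Queries
import Literature.Computability.QuantumComplexity.AaronsonAmbainisSimTreeWalk
import HarnessLib

/-!
# Aaronson–Ambainis 2014, Thm. 23: the moments of the restricted acceptance polynomial as integer path-tuple sums

The polynomial-TIME half of the proof of Aaronson–Ambainis' Thm. 23 (arXiv:0911.0996v3, p. 14)
evaluates, at every node `ρ` of the simulation tree of Thm. 21 run on the acceptance polynomial
`p_x` of a `BQP^A` machine, the quantities `E[p_ρ]`, `Vr[p_ρ]` and `Inf_i[p_ρ]` exactly, "using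
`P^{#P}`": each is a sum over tuples of computation paths. This file proves the corresponding
identities in the tree's model, where `p_x = acceptPoly F x` (`AaronsonAmbainisThm23Queries.lean`)
takes at the oracle bits `y ∈ {0,1}^M` the value `Pr[F^{oracleOf y} accepts x]`, which is the
`√2`-form `(2·gSumA + √2·gSumB)/2^{h+1}` of sums over PAIRS of consistent guessed paths
(`GuessedOracleRuns.acceptProbOn_eq_sqrtTwoForm_guessed`), and where the probability that a tuple of
guessed paths is consistent with the (overridden, possibly bit-flipped) random oracle is
`[Cons]·2^{−|freeIdx|}` (`OracleReadCounting.boolAvg_sat`):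

* `readsI` (the reads of a guessed walk with oracle-bit INDICES), `consA_oracleOf_iff`; the pair
  and quadruple sums `pairSum t ρ i`, `quadSum t₁ t₂ fl ρ i` (integers: tuple weight `t ∈ {0, ±1}`
  times `[Cons]·2^{K − |freeIdx|}`, `K = 2μ` resp. `4μ`, `μ` = number of gates);
* **`boolAvg_accept_view`**: `E_y[p_x(y|ρ)] = (2·pairSum t_A + √2·pairSum t_B)/2^{h+1+2μ}`;
  **`boolAvg_accept_view_mul`**: `E_y[p_x(y|ρ) · p_x(y^{(i,fl)}|ρ)]` as
  `(4 q_AA + 2 q_BB + 2√2 (q_AB + q_BA))/2^{2h+2+4μ}` with the quadruple sums for the flip bit `fl`;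
* hence the node quantities of the tree: **`boolAvg_nodePoly_eq`**, **`boolVariance_nodePoly_eq`**,
  **`influence_nodePoly_eq`** — `E`, `Vr`, `Inf_i` of `nodePoly (acceptPoly F x) ρ` as
  `(a + b√2)/2^e` with explicit INTEGER `a, b` (`ℤ`-linear combinations of the sums);
* and the three exact tests of the tree as integer sign conditions (`StateVectorDP.posSqrtTwoTest`):
  **`half_le_boolAvg_nodePoly_iff`**, **`boolVariance_nodePoly_le_iff`**, **`le_influence_nodePoly_iff`**.

These are the statements the counting machine of the sequel implements (the sums are `#P`-style
counts, the tests integer arithmetic on them). No named facts.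

## References

* S. Aaronson, A. Ambainis, *The need for structure in quantum speedups*, Theory Comput. 10
  (2014), proof of Thm. 23 (arXiv:0911.0996v3, p. 14: "`E[p_j]` is computable in `P^{#P}` …
  `Vr[p_j]` … `Inf_i[p_j]` … in the counting hierarchy") [AaronsonAmbainis2014].
* E. Bernstein, U. Vazirani, *Quantum complexity theory*, SIAM J. Comput. 26 (1997), §8.4, Thm. 8.11
  (`BQP ⊆ P^{#P}`: amplitudes as sums over paths) [BernsteinVazirani1997].
-/

noncomputable section

namespace Literature.Computability.QuantumComplexity

open _root_.Computability Complexity Cryptography ADH OracleReads Finset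

/-! ### Averages over the cube: linearity and flip invariance -/

section Avg

variable {M : ℕ}

/-- Linearity of the average. [folklore] -/
theorem boolAvg_add (f g : (Fin M → Bool) → ℝ) : boolAvg (fun y => f y + g y) = boolAvg f + boolAvg g := by
  unfold boolAvg; rw [Finset.sum_add_distrib, add_div]

/-- Linearity of the average. [folklore] -/
theorem boolAvg_sub (f g : (Fin M → Bool) → ℝ) : boolAvg (fun y => f y - g y) = boolAvg f - boolAvg g := by
  unfold boolAvg; rw [Finset.sum_sub_distrib, sub_div]

/-- Linearity of the average. [folklore] -/
theorem boolAvg_const_mul (a : ℝ) (f : (Fin M → Bool) → ℝ) : boolAvg (fun y => a * f y) = a * boolAvg f := by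
  unfold boolAvg; rw [← Finset.mul_sum, mul_div_assoc]

/-- Linearity of the average. [folklore] -/
theorem boolAvg_mul_const (a : ℝ) (f : (Fin M → Bool) → ℝ) : boolAvg (fun y => f y * a) = boolAvg f * a := by
  unfold boolAvg; rw [← Finset.sum_mul, div_mul_eq_mul_div]

/-- Linearity of the average. [folklore] -/
theorem boolAvg_div_const (a : ℝ) (f : (Fin M → Bool) → ℝ) : boolAvg (fun y => f y / a) = boolAvg f / a := by
  unfold boolAvg; rw [← Finset.sum_div, div_div, div_div, mul_comm]

/-- The average of a finite sum of functions. [folklore] -/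
theorem boolAvg_finset_sum {ι : Type*} (s : Finset ι) (f : ι → (Fin M → Bool) → ℝ) :
    boolAvg (fun y => ∑ t ∈ s, f t y) = ∑ t ∈ s, boolAvg (f t) := by
  unfold boolAvg; rw [Finset.sum_comm, Finset.sum_div]

/-- **Flip invariance**: `E_y[g(y^i)] = E_y[g(y)]`. [folklore] -/
theorem boolAvg_comp_flipBit (i : Fin M) (g : (Fin M → Bool) → ℝ) : boolAvg (fun y => g (flipBit i y)) = boolAvg g := by
  unfold boolAvg
  congr 1
  exact Equiv.sum_comp (Function.Involutive.toPerm (flipBit i) (flipBit_flipBit i)) g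

/-- `Var[p] = E[p²] − E[p]²`. [folklore] -/
theorem boolVariance_eq_avg_sq_sub (p : MvPolynomial (Fin M) ℝ) :
    boolVariance p = boolAvg (fun y => evalBool p y * evalBool p y) - boolAvg (evalBool p) * boolAvg (evalBool p) := by
  unfold boolVariance
  set m := boolAvg (evalBool p)
  have : (fun y => (evalBool p y - m) ^ 2) = fun y => evalBool p y * evalBool p y - 2 * m * evalBool p y + m * m := by
    funext y; ring
  rw [this]
  rw [show (fun y => evalBool p y * evalBool p y - 2 * m * evalBool p y + m * m) =
      fun y => (evalBool p y * evalBool p y - 2 * m * evalBool p y) + m * m from rfl, boolAvg_add, boolAvg_sub,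
    boolAvg_const_mul, boolAvg_const]
  ring

/-- `Inf_i[p] = 2 (E[p²] − E[p · p∘flip_i])`. [folklore] -/
theorem influence_eq_two_mul_sub (i : Fin M) (p : MvPolynomial (Fin M) ℝ) :
    influence i p = 2 * (boolAvg (fun y => evalBool p y * evalBool p y) -
      boolAvg (fun y => evalBool p y * evalBool p (flipBit i y))) := by
  unfold influence
  have : (fun y => (evalBool p y - evalBool p (flipBit i y)) ^ 2) = fun y =>
      (evalBool p y * evalBool p y - evalBool p y * evalBool p (flipBit i y)) +
        ((fun z => evalBool p z * evalBool p z - evalBool p z * evalBool p (flipBit i z)) (flipBit i y)) := by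
    funext y; simp only [flipBit_flipBit]; ring
  rw [this, boolAvg_add,
    boolAvg_comp_flipBit i (fun z => evalBool p z * evalBool p z - evalBool p z * evalBool p (flipBit i z)), boolAvg_sub]
  ring

end Avg

/-! ### Reads with oracle-bit indices -/

section Reads

variable (F : QCircuitFamily cliffordT) (x : List Bool)

/-- **The reads of a guessed walk with oracle-bit indices** (`bitEquiv` of the query string) in
place of query strings (same recursion as `ADH.readsO`). [cite: AaronsonAmbainis2014, proof of Thm. 23 (p. 14)] -/
def readsI : List (QGate cliffordT (oracleWidth F x)) → List Bool → QReg (oracleWidth F x) →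
    List (Fin (numOracleBits F x) × Bool)
  | [], _, _ => []
  | .gate g e :: gs, cs, w => readsI gs cs.tail (lStepO (.gate g e) (headBit cs) w)
  | .oracle k e :: gs, cs, w =>
      (bitEquiv F x ⟨queryOf e w, mem_shortStrings.2 (length_queryOf_lt e w)⟩, headBit cs) ::
        readsI gs cs.tail (lStepO (.oracle k e) (headBit cs) w)

/-- At most one read per gate. [folklore] -/
theorem length_readsI_le : ∀ (gs : List (QGate cliffordT (oracleWidth F x))) (cs : List Bool) (w : QReg (oracleWidth F x)),
    (readsI F x gs cs w).length ≤ gs.length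
  | [], _, _ => le_rfl
  | .gate g e :: gs, cs, w => (length_readsI_le gs _ _).trans (by simp)
  | .oracle k e :: gs, cs, w => by simp only [readsI, List.length_cons]; exact Nat.succ_le_succ (length_readsI_le gs _ _)

/-- Membership in `oracleOf`: a short string is in the oracle iff its bit is set. [folklore] -/
theorem boolIndicator_oracleOf (z : Fin (numOracleBits F x) → Bool) {q : List Bool} (hq : q ∈ shortStrings (oracleWidth F x)) :
    (oracleOf F x z).boolIndicator q = z (bitEquiv F x ⟨q, hq⟩) := by
  unfold Set.boolIndicator oracleOf
  by_cases h : z (bitEquiv F x ⟨q, hq⟩) = true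
  · rw [if_pos ⟨hq, h⟩, h]
  · rw [if_neg (by rintro ⟨h', hh⟩; exact h hh)]
    cases hz : z (bitEquiv F x ⟨q, hq⟩)
    · rfl
    · exact absurd hz h

/-- **Consistency with `oracleOf z` is agreement of the indexed reads with `z`.** [folklore] -/
theorem consA_oracleOf_iff (z : Fin (numOracleBits F x) → Bool) :
    ∀ (gs : List (QGate cliffordT (oracleWidth F x))) (cs : List Bool) (w : QReg (oracleWidth F x)),
      ConsA (oracleOf F x z) gs cs w ↔ ∀ r ∈ readsI F x gs cs w, z r.1 = r.2
  | [], cs, w => by simp [ConsA, readsO, readsI]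
  | .gate g e :: gs, cs, w => by
    rw [readsI, ← consA_oracleOf_iff z gs]
    simp [ConsA, readsO_gate]
  | .oracle k e :: gs, cs, w => by
    rw [readsI]
    simp only [List.mem_cons, forall_eq_or_imp]
    rw [← consA_oracleOf_iff z gs]
    unfold ConsA
    simp only [readsO_oracle, List.mem_cons, forall_eq_or_imp]
    rw [boolIndicator_oracleOf F x z (mem_shortStrings.2 (length_queryOf_lt e w))]
    constructor
    · rintro ⟨h1, h2⟩; exact ⟨h1.symm, h2⟩
    · rintro ⟨h1, h2⟩; exact ⟨h1.symm, h2⟩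

end Reads

/-! ### The path-tuple sums -/

section Sums

variable (F : QCircuitFamily cliffordT) (x : List Bool)

/-- The reads of the guessed coin string `c` of `F_{|x|}` from `|x 0^m⟩`, tagged with the flip bit `fl`. [folklore] -/
def rd (c : Fin (accGates F x).length → Bool) (fl : Bool) : List (Fin (numOracleBits F x) × Bool × Bool) :=
  (readsI F x (accGates F x) (List.ofFn c) (accInput F x)).map fun r => (r.1, r.2, fl)

/-- The total state of the guessed coin string `c`. [folklore] -/
def st (c : Fin (accGates F x).length → Bool) : TState (oracleWidth F x) :=
  tRunO (accGates F x) (List.ofFn c) (accInput F x, 0, true)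

/-- The `A`-part pair term of two guessed coin strings (`∈ {0, ±1}`). [folklore] -/
def tA (c c' : Fin (accGates F x).length → Bool) : ℤ := pairTermA (QCircuit.acceptEvent _) (st F x c) (st F x c')

/-- The `B`-part pair term of two guessed coin strings (`∈ {0, ±1}`). [folklore] -/
def tB (c c' : Fin (accGates F x).length → Bool) : ℤ := pairTermB (QCircuit.acceptEvent _) (st F x c) (st F x c')

/-- The scale `K = 2μ` of the pair sums (`μ` = number of gates; a pair of paths has `≤ 2μ` reads). [folklore] -/
def K2 : ℕ := 2 * (accGates F x).length

open scoped Classical in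
/-- **The consistency weight** of a read list at scale `K`: `[Cons ρ i R] · 2^{K − |freeIdx ρ R|}` —
`2^K` times the probability that the random oracle, overridden by `ρ` (and flipped at `i` for the
flipped reads), answers all reads of `R` as guessed. [cite: AaronsonAmbainis2014, proof of Thm. 23 (p. 14)] -/
def consWt (ρ : List (Fin (numOracleBits F x) × Bool)) (i : Fin (numOracleBits F x))
    (R : List (Fin (numOracleBits F x) × Bool × Bool)) (K : ℕ) : ℤ :=
  if Cons ρ i R then 2 ^ (K - (freeIdx ρ R).card) else 0

/-- **The pair sum** of a pair weight `t`: `Σ_{c,c'} t(c,c') · consWt (rd c ++ rd c') (2μ)` (all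
reads unflipped). For `t = tA, tB` these are `2^{2μ} · E_y[gSumA]`, `2^{2μ} · E_y[gSumB]`. [cite: AaronsonAmbainis2014, proof of Thm. 23 (p. 14: "E[p_j] is computable in P^{#P}")] -/
def pairSum (t : (Fin (accGates F x).length → Bool) → (Fin (accGates F x).length → Bool) → ℤ)
    (ρ : List (Fin (numOracleBits F x) × Bool)) (i : Fin (numOracleBits F x)) : ℤ :=
  ∑ c : Fin (accGates F x).length → Bool, ∑ c' : Fin (accGates F x).length → Bool,
    t c c' * consWt F x ρ i (rd F x c false ++ rd F x c' false) (K2 F x)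

/-- **The quadruple sum** of two pair weights and a flip bit: `Σ t₁(c₁,c₁') t₂(c₂,c₂') ·
consWt (rd c₁ ++ rd c₁' ++ rd^{fl} c₂ ++ rd^{fl} c₂') (4μ)` — `2^{4μ}` times
`E_y[S₁(y|ρ) · S₂(y^{(i,fl)}|ρ)]`. [cite: AaronsonAmbainis2014, proof of Thm. 23 (p. 14: "Vr[p_j] … Inf_i[p_j] … counting hierarchy")] -/
def quadSum (t₁ t₂ : (Fin (accGates F x).length → Bool) → (Fin (accGates F x).length → Bool) → ℤ) (fl : Bool)
    (ρ : List (Fin (numOracleBits F x) × Bool)) (i : Fin (numOracleBits F x)) : ℤ :=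
  ∑ c₁ : Fin (accGates F x).length → Bool, ∑ c₁' : Fin (accGates F x).length → Bool,
    ∑ c₂ : Fin (accGates F x).length → Bool, ∑ c₂' : Fin (accGates F x).length → Bool,
      t₁ c₁ c₁' * t₂ c₂ c₂' *
        consWt F x ρ i ((rd F x c₁ false ++ rd F x c₁' false) ++ (rd F x c₂ fl ++ rd F x c₂' fl)) (2 * K2 F x)

end Sums

/-! ### The sums over consistent pairs at a view, and their averages -/

section Views

variable (F : QCircuitFamily cliffordT) (x : List Bool)
variable (ρ : List (Fin (numOracleBits F x) × Bool)) (i : Fin (numOracleBits F x))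

open scoped Classical in
/-- The indicator of `Sat`. [folklore] -/
def satInd (y : Fin (numOracleBits F x) → Bool) (R : List (Fin (numOracleBits F x) × Bool × Bool)) : ℝ :=
  if Sat ρ i y R then 1 else 0

/-- Satisfaction of a concatenation. [folklore] -/
theorem sat_append_iff (y : Fin (numOracleBits F x) → Bool) (R₁ R₂ : List (Fin (numOracleBits F x) × Bool × Bool)) :
    Sat ρ i y (R₁ ++ R₂) ↔ Sat ρ i y R₁ ∧ Sat ρ i y R₂ := by
  unfold Sat
  simp only [List.mem_append, or_imp, forall_and]

/-- Indicators multiply to the indicator of the concatenation. [folklore] -/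
theorem satInd_mul (y : Fin (numOracleBits F x) → Bool) (R₁ R₂ : List (Fin (numOracleBits F x) × Bool × Bool)) :
    satInd F x ρ i y R₁ * satInd F x ρ i y R₂ = satInd F x ρ i y (R₁ ++ R₂) := by
  unfold satInd
  by_cases h1 : Sat ρ i y R₁ <;> by_cases h2 : Sat ρ i y R₂ <;> simp [sat_append_iff, h1, h2]



/-- **The average of a weighted indicator is the consistency weight**: `E_y[1_{Sat R} · a] = a · consWt R K / 2^K`
for `|R| ≤ K`. [cite: AaronsonAmbainis2014, proof of Thm. 23 (p. 14)] -/
theorem boolAvg_satInd_mul (R : List (Fin (numOracleBits F x) × Bool × Bool)) (a : ℝ) {K : ℕ} (hK : R.length ≤ K) :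
    boolAvg (fun y => satInd F x ρ i y R * a) = a * (consWt F x ρ i R K : ℝ) / 2 ^ K := by
  classical
  rw [boolAvg_mul_const]
  have h := boolAvg_sat ρ i R
  have hfree : (freeIdx ρ R).card ≤ K := by
    refine le_trans ?_ hK
    unfold freeIdx
    refine (List.toFinset_card_le _).trans ?_
    rw [List.length_map]
    exact List.length_filter_le _ _
  unfold satInd consWt
  rw [h]
  have hpow : (2 : ℝ) ^ K = 2 ^ (K - (freeIdx ρ R).card) * 2 ^ (freeIdx ρ R).card := by
    rw [← pow_add, Nat.sub_add_cancel hfree]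
  split_ifs with hC
  · push_cast
    rw [inv_pow, hpow]
    field_simp
  · simp

/-- The sum of a pair weight over the pairs consistent at the view `(ρ, i, fl)` of `y`. [folklore] -/
def viewSum (t : (Fin (accGates F x).length → Bool) → (Fin (accGates F x).length → Bool) → ℤ) (fl : Bool)
    (y : Fin (numOracleBits F x) → Bool) : ℝ :=
  ∑ c : Fin (accGates F x).length → Bool, ∑ c' : Fin (accGates F x).length → Bool,
    satInd F x ρ i y (rd F x c fl ++ rd F x c' fl) * t c c'

/-- Consistency of a pair with the oracle of a view is satisfaction of its tagged reads. [folklore] -/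
theorem consA_view_iff (fl : Bool) (y : Fin (numOracleBits F x) → Bool) (c c' : Fin (accGates F x).length → Bool) :
    (ConsA (oracleOf F x (view ρ i y fl)) (accGates F x) (List.ofFn c) (accInput F x) ∧
      ConsA (oracleOf F x (view ρ i y fl)) (accGates F x) (List.ofFn c') (accInput F x)) ↔
    Sat ρ i y (rd F x c fl ++ rd F x c' fl) := by
  rw [consA_oracleOf_iff, consA_oracleOf_iff]
  unfold Sat rd
  simp only [List.forall_mem_append, List.forall_mem_map]

/-- **The guessed sums at the oracle of a view are the view sums.** [folklore] -/
theorem gSumA_view (fl : Bool) (y : Fin (numOracleBits F x) → Bool) :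
    (gSumA F (oracleOf F x (view ρ i y fl)) x : ℝ) = viewSum F x ρ i (tA F x) fl y := by
  classical
  unfold gSumA viewSum
  push_cast
  refine Finset.sum_congr rfl fun c _ => Finset.sum_congr rfl fun c' _ => ?_
  rw [if_congr (consA_view_iff F x ρ i fl y c c') rfl rfl]
  unfold satInd tA st
  split_ifs <;> simp

/-- **The guessed sums at the oracle of a view are the view sums.** [folklore] -/
theorem gSumB_view (fl : Bool) (y : Fin (numOracleBits F x) → Bool) :
    (gSumB F (oracleOf F x (view ρ i y fl)) x : ℝ) = viewSum F x ρ i (tB F x) fl y := by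
  classical
  unfold gSumB viewSum
  push_cast
  refine Finset.sum_congr rfl fun c _ => Finset.sum_congr rfl fun c' _ => ?_
  rw [if_congr (consA_view_iff F x ρ i fl y c c') rfl rfl]
  unfold satInd tB st
  split_ifs <;> simp

/-- **The acceptance probability at the oracle of a view**, as a `√2`-form of view sums. [folklore] -/
theorem acceptProbOn_view (fl : Bool) (y : Fin (numOracleBits F x) → Bool) :
    F.acceptProbOn (oracleOf F x (view ρ i y fl)) x =
      (2 * viewSum F x ρ i (tA F x) fl y + Real.sqrt 2 * viewSum F x ρ i (tB F x) fl y) /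
        2 ^ (hCount (accGates F x) + 1) := by
  rw [acceptProbOn_eq_sqrtTwoForm_guessed, SqrtTwoDyadic.sqrtTwoForm, gSumA_view, gSumB_view]

/-- Reads of a coin string are at most the number of gates. [folklore] -/
theorem length_rd_le (c : Fin (accGates F x).length → Bool) (fl : Bool) : (rd F x c fl).length ≤ (accGates F x).length := by
  unfold rd; rw [List.length_map]; exact length_readsI_le F x _ _ _

/-- **Average of a view sum**: `E_y[viewSum t false] = pairSum t / 2^{2μ}`. [cite: AaronsonAmbainis2014, proof of Thm. 23 (p. 14)] -/
theorem boolAvg_viewSum (t : (Fin (accGates F x).length → Bool) → (Fin (accGates F x).length → Bool) → ℤ) :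
    boolAvg (viewSum F x ρ i t false) = (pairSum F x t ρ i : ℝ) / 2 ^ K2 F x := by
  unfold viewSum pairSum
  rw [boolAvg_finset_sum]
  push_cast
  rw [Finset.sum_div]
  refine Finset.sum_congr rfl fun c _ => ?_
  rw [boolAvg_finset_sum, Finset.sum_div]
  refine Finset.sum_congr rfl fun c' _ => ?_
  rw [boolAvg_satInd_mul F x ρ i _ _ (K := K2 F x) (by
    rw [List.length_append]; have := length_rd_le F x c false; have := length_rd_le F x c' false; unfold K2; omega)]

/-- **Average of a product of view sums**: `E_y[viewSum t₁ false · viewSum t₂ fl] = quadSum t₁ t₂ fl / 2^{4μ}`. [cite: AaronsonAmbainis2014, proof of Thm. 23 (p. 14)] -/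
theorem boolAvg_viewSum_mul (t₁ t₂ : (Fin (accGates F x).length → Bool) → (Fin (accGates F x).length → Bool) → ℤ) (fl : Bool) :
    boolAvg (fun y => viewSum F x ρ i t₁ false y * viewSum F x ρ i t₂ fl y) =
      (quadSum F x t₁ t₂ fl ρ i : ℝ) / 2 ^ (2 * K2 F x) := by
  unfold viewSum quadSum
  simp_rw [Finset.sum_mul, Finset.mul_sum]
  rw [boolAvg_finset_sum]; push_cast; rw [Finset.sum_div]
  refine Finset.sum_congr rfl fun c₁ _ => ?_
  rw [boolAvg_finset_sum, Finset.sum_div]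
  refine Finset.sum_congr rfl fun c₁' _ => ?_
  rw [boolAvg_finset_sum, Finset.sum_div]
  refine Finset.sum_congr rfl fun c₂ _ => ?_
  rw [boolAvg_finset_sum, Finset.sum_div]
  refine Finset.sum_congr rfl fun c₂' _ => ?_
  have hre : (fun y => satInd F x ρ i y (rd F x c₁ false ++ rd F x c₁' false) * (t₁ c₁ c₁' : ℝ) *
      (satInd F x ρ i y (rd F x c₂ fl ++ rd F x c₂' fl) * (t₂ c₂ c₂' : ℝ))) =
      fun y => satInd F x ρ i y ((rd F x c₁ false ++ rd F x c₁' false) ++ (rd F x c₂ fl ++ rd F x c₂' fl)) *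
        ((t₁ c₁ c₁' : ℝ) * t₂ c₂ c₂') := by
    funext y
    rw [mul_mul_mul_comm, satInd_mul]
  rw [hre, boolAvg_satInd_mul F x ρ i _ _ (K := 2 * K2 F x) (by
    simp only [List.length_append]
    have := length_rd_le F x c₁ false; have := length_rd_le F x c₁' false
    have := length_rd_le F x c₂ fl; have := length_rd_le F x c₂' fl; unfold K2; omega)]

/-- **`E_y[p_x(y|ρ)] = (2·pairSum t_A + √2·pairSum t_B)/2^{h+1+2μ}`.** [cite: AaronsonAmbainis2014, proof of Thm. 23 (p. 14: "E[p_j] is computable in P^{#P}")] -/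
theorem boolAvg_accept_view :
    boolAvg (fun y => F.acceptProbOn (oracleOf F x (view ρ i y false)) x) =
      (2 * pairSum F x (tA F x) ρ i + Real.sqrt 2 * pairSum F x (tB F x) ρ i) /
        2 ^ (hCount (accGates F x) + 1 + K2 F x) := by
  simp_rw [acceptProbOn_view]
  rw [boolAvg_div_const]
  rw [show (fun y => 2 * viewSum F x ρ i (tA F x) false y + Real.sqrt 2 * viewSum F x ρ i (tB F x) false y) =
      fun y => 2 * viewSum F x ρ i (tA F x) false y + Real.sqrt 2 * viewSum F x ρ i (tB F x) false y from rfl,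
    boolAvg_add, boolAvg_const_mul, boolAvg_const_mul]
  rw [boolAvg_viewSum, boolAvg_viewSum, pow_add]
  have h2 : (2 : ℝ) ^ K2 F x ≠ 0 := by positivity
  have h3 : (2 : ℝ) ^ (hCount (accGates F x) + 1) ≠ 0 := by positivity
  field_simp
  ring

/-- **`E_y[p_x(y|ρ) · p_x(y^{(i,fl)}|ρ)] = (4 q_AA + 2 q_BB + 2√2 (q_AB + q_BA))/2^{2h+2+4μ}`.** [cite: AaronsonAmbainis2014, proof of Thm. 23 (p. 14)] -/
theorem boolAvg_accept_view_mul (fl : Bool) :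
    boolAvg (fun y => F.acceptProbOn (oracleOf F x (view ρ i y false)) x * F.acceptProbOn (oracleOf F x (view ρ i y fl)) x) =
      (4 * quadSum F x (tA F x) (tA F x) fl ρ i + 2 * quadSum F x (tB F x) (tB F x) fl ρ i +
        2 * Real.sqrt 2 * (quadSum F x (tA F x) (tB F x) fl ρ i + quadSum F x (tB F x) (tA F x) fl ρ i)) /
        2 ^ (2 * hCount (accGates F x) + 2 + 2 * K2 F x) := by
  simp_rw [acceptProbOn_view]
  have hs : Real.sqrt 2 * Real.sqrt 2 = 2 := Real.mul_self_sqrt (by norm_num)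
  set h := hCount (accGates F x)
  have hexp : ∀ y, (2 * viewSum F x ρ i (tA F x) false y + Real.sqrt 2 * viewSum F x ρ i (tB F x) false y) / 2 ^ (h + 1) *
      ((2 * viewSum F x ρ i (tA F x) fl y + Real.sqrt 2 * viewSum F x ρ i (tB F x) fl y) / 2 ^ (h + 1)) =
      (4 * (viewSum F x ρ i (tA F x) false y * viewSum F x ρ i (tA F x) fl y) +
        2 * (viewSum F x ρ i (tB F x) false y * viewSum F x ρ i (tB F x) fl y) +
        2 * Real.sqrt 2 * (viewSum F x ρ i (tA F x) false y * viewSum F x ρ i (tB F x) fl y) +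
        2 * Real.sqrt 2 * (viewSum F x ρ i (tB F x) false y * viewSum F x ρ i (tA F x) fl y)) / 2 ^ (2 * h + 2) := by
    intro y
    rw [div_mul_div_comm, ← pow_add, show h + 1 + (h + 1) = 2 * h + 2 by ring]
    congr 1
    linear_combination (viewSum F x ρ i (tB F x) false y * viewSum F x ρ i (tB F x) fl y) * hs
  simp_rw [hexp]
  rw [boolAvg_div_const, boolAvg_add, boolAvg_add, boolAvg_add, boolAvg_const_mul, boolAvg_const_mul, boolAvg_const_mul,
    boolAvg_const_mul, boolAvg_viewSum_mul, boolAvg_viewSum_mul, boolAvg_viewSum_mul, boolAvg_viewSum_mul]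
  rw [show 2 * h + 2 + 2 * K2 F x = (2 * h + 2) + 2 * K2 F x by ring, pow_add _ (2 * h + 2)]
  field_simp
  ring

end Views

/-! ### The node quantities of the simulation tree -/

section Node

variable (F : QCircuitFamily cliffordT) (x : List Bool)
variable (ρ : List (Fin (numOracleBits F x) × Bool)) (i : Fin (numOracleBits F x))

/-- `p_x` at a point of the cube is the acceptance probability at the oracle with those bits. [cite: AaronsonAmbainis2014, Lemma 20] -/
theorem evalBool_acceptPoly_eq (b : Fin (numOracleBits F x) → Bool) :
    evalBool (acceptPoly F x) b = F.acceptProbOn (oracleOf F x b) x := by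
  rw [← oracleBits_oracleOf F x b, evalBool_acceptPoly, oracleBits_oracleOf]

/-- **The node polynomial at `y` is `p_x` at the view `y|ρ`.** [cite: AaronsonAmbainis2014, Thm. 3.3 (proof) and proof of Thm. 23] -/
theorem evalBool_nodePoly_acceptPoly (y : Fin (numOracleBits F x) → Bool) :
    evalBool (ClassicalSimulation.nodePoly (acceptPoly F x) ρ) y = F.acceptProbOn (oracleOf F x (view ρ i y false)) x := by
  rw [ClassicalSimulation.evalBool_nodePoly, evalBool_acceptPoly_eq]
  rfl

/-- **The node polynomial at `y^i` is `p_x` at the flipped view.** [cite: AaronsonAmbainis2014, §1 (Inf_i) and proof of Thm. 23] -/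
theorem evalBool_nodePoly_acceptPoly_flipBit (y : Fin (numOracleBits F x) → Bool) :
    evalBool (ClassicalSimulation.nodePoly (acceptPoly F x) ρ) (flipBit i y) =
      F.acceptProbOn (oracleOf F x (view ρ i y true)) x := by
  rw [ClassicalSimulation.evalBool_nodePoly, evalBool_acceptPoly_eq]
  rfl

/-- The scale exponent `2h + 2 + 4μ` of the second moments. [folklore] -/
def D2 : ℕ := 2 * hCount (accGates F x) + 2 + 2 * K2 F x

/-- The integer `√2`-free part of `2^{D2} · Vr[p_ρ]`. [cite: AaronsonAmbainis2014, proof of Thm. 23 (p. 14: "Vr[p_j]")] -/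
def varA : ℤ :=
  4 * quadSum F x (tA F x) (tA F x) false ρ i + 2 * quadSum F x (tB F x) (tB F x) false ρ i -
    4 * pairSum F x (tA F x) ρ i ^ 2 - 2 * pairSum F x (tB F x) ρ i ^ 2

/-- The integer `√2`-part of `2^{D2} · Vr[p_ρ]`. [cite: AaronsonAmbainis2014, proof of Thm. 23 (p. 14: "Vr[p_j]")] -/
def varB : ℤ :=
  2 * (quadSum F x (tA F x) (tB F x) false ρ i + quadSum F x (tB F x) (tA F x) false ρ i) -
    4 * pairSum F x (tA F x) ρ i * pairSum F x (tB F x) ρ i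

/-- The integer `√2`-free part of `2^{D2} · Inf_i[p_ρ]`. [cite: AaronsonAmbainis2014, proof of Thm. 23 (p. 14: "Inf_i[p_j]")] -/
def infA : ℤ :=
  8 * (quadSum F x (tA F x) (tA F x) false ρ i - quadSum F x (tA F x) (tA F x) true ρ i) +
    4 * (quadSum F x (tB F x) (tB F x) false ρ i - quadSum F x (tB F x) (tB F x) true ρ i)

/-- The integer `√2`-part of `2^{D2} · Inf_i[p_ρ]`. [cite: AaronsonAmbainis2014, proof of Thm. 23 (p. 14: "Inf_i[p_j]")] -/
def infB : ℤ :=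
  4 * ((quadSum F x (tA F x) (tB F x) false ρ i + quadSum F x (tB F x) (tA F x) false ρ i) -
    (quadSum F x (tA F x) (tB F x) true ρ i + quadSum F x (tB F x) (tA F x) true ρ i))

/-- **`E[p_ρ] = (2·pairSum t_A + √2·pairSum t_B)/2^{h+1+2μ}`.** [cite: AaronsonAmbainis2014, proof of Thm. 23 (p. 14: "E[p_j] is computable in P^{#P}")] -/
theorem boolAvg_nodePoly_eq :
    boolAvg (evalBool (ClassicalSimulation.nodePoly (acceptPoly F x) ρ)) =
      (2 * pairSum F x (tA F x) ρ i + Real.sqrt 2 * pairSum F x (tB F x) ρ i) /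
        2 ^ (hCount (accGates F x) + 1 + K2 F x) := by
  rw [show evalBool (ClassicalSimulation.nodePoly (acceptPoly F x) ρ) =
      fun y => F.acceptProbOn (oracleOf F x (view ρ i y false)) x from funext (evalBool_nodePoly_acceptPoly F x ρ i)]
  exact boolAvg_accept_view F x ρ i

/-- **`E[p_ρ²]` and `E[p_ρ · p_ρ∘flip_i]` as quadruple sums.** [cite: AaronsonAmbainis2014, proof of Thm. 23 (p. 14)] -/
theorem boolAvg_nodePoly_mul_eq (fl : Bool) :
    boolAvg (fun y => evalBool (ClassicalSimulation.nodePoly (acceptPoly F x) ρ) y *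
        evalBool (ClassicalSimulation.nodePoly (acceptPoly F x) ρ) (if fl then flipBit i y else y)) =
      (4 * quadSum F x (tA F x) (tA F x) fl ρ i + 2 * quadSum F x (tB F x) (tB F x) fl ρ i +
        2 * Real.sqrt 2 * (quadSum F x (tA F x) (tB F x) fl ρ i + quadSum F x (tB F x) (tA F x) fl ρ i)) /
        2 ^ D2 F x := by
  have h : ∀ y, evalBool (ClassicalSimulation.nodePoly (acceptPoly F x) ρ) (if fl then flipBit i y else y) =
      F.acceptProbOn (oracleOf F x (view ρ i y fl)) x := by
    intro y; cases fl
    · exact evalBool_nodePoly_acceptPoly F x ρ i y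
    · exact evalBool_nodePoly_acceptPoly_flipBit F x ρ i y
  have hfun : (fun y => evalBool (ClassicalSimulation.nodePoly (acceptPoly F x) ρ) y *
        evalBool (ClassicalSimulation.nodePoly (acceptPoly F x) ρ) (if fl then flipBit i y else y)) =
      fun y => F.acceptProbOn (oracleOf F x (view ρ i y false)) x * F.acceptProbOn (oracleOf F x (view ρ i y fl)) x :=
    funext fun y => by rw [evalBool_nodePoly_acceptPoly F x ρ i y, h y]
  rw [hfun]
  exact boolAvg_accept_view_mul F x ρ i fl

/-- **`Vr[p_ρ] = (varA + √2·varB)/2^{2h+2+4μ}`.** [cite: AaronsonAmbainis2014, proof of Thm. 23 (p. 14: "Vr[p_j] … is computable")] -/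
theorem boolVariance_nodePoly_eq :
    boolVariance (ClassicalSimulation.nodePoly (acceptPoly F x) ρ) =
      (varA F x ρ i + Real.sqrt 2 * varB F x ρ i) / 2 ^ D2 F x := by
  rw [boolVariance_eq_avg_sq_sub, boolAvg_nodePoly_eq F x ρ i]
  have h2 := boolAvg_nodePoly_mul_eq F x ρ i false
  simp only [Bool.false_eq_true, ↓reduceIte] at h2
  rw [h2]
  have hs : Real.sqrt 2 * Real.sqrt 2 = 2 := Real.mul_self_sqrt (by norm_num)
  have hD : (2 : ℝ) ^ D2 F x = 2 ^ (hCount (accGates F x) + 1 + K2 F x) * 2 ^ (hCount (accGates F x) + 1 + K2 F x) := by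
    rw [← pow_add]; unfold D2; ring_nf
  unfold varA varB
  push_cast
  rw [div_mul_div_comm, ← hD, ← sub_div]
  congr 1
  linear_combination (-(pairSum F x (tB F x) ρ i : ℝ) ^ 2) * hs

/-- **`Inf_i[p_ρ] = (infA + √2·infB)/2^{2h+2+4μ}`.** [cite: AaronsonAmbainis2014, proof of Thm. 23 (p. 14: "Inf_i[p_j] … is computable")] -/
theorem influence_nodePoly_eq :
    influence i (ClassicalSimulation.nodePoly (acceptPoly F x) ρ) =
      (infA F x ρ i + Real.sqrt 2 * infB F x ρ i) / 2 ^ D2 F x := by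
  rw [influence_eq_two_mul_sub]
  have h0 := boolAvg_nodePoly_mul_eq F x ρ i false
  have h1 := boolAvg_nodePoly_mul_eq F x ρ i true
  simp only [Bool.false_eq_true, ↓reduceIte] at h0 h1
  rw [h0, h1, ← sub_div, ← mul_div_assoc]
  unfold infA infB
  push_cast
  congr 1
  ring

/-! ### The exact tests as integer sign conditions -/

/-- **Comparing a `√2`-form with a rational, above**: `(a + b√2)/2^e ≤ u/v ↔ ¬(0 < (va − u2^e) + vb·√2)`.
[cite: AaronsonAmbainis2014, proof of Thm. 23 (p. 14: the comparisons are exact)] -/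
theorem sqrtTwo_div_le_div_iff (a b : ℤ) (e u : ℕ) {v : ℕ} (hv : 0 < v) :
    ((a : ℝ) + Real.sqrt 2 * b) / 2 ^ e ≤ u / v ↔ posSqrtTwoTest ((v : ℤ) * a - (u : ℤ) * 2 ^ e) ((v : ℤ) * b) = false := by
  rw [← Bool.not_eq_true, posSqrtTwoTest_iff, div_le_div_iff₀ (by positivity) (by exact_mod_cast hv), not_lt]
  push_cast
  constructor <;> intro h <;> nlinarith [h]

/-- **Comparing a `√2`-form with a rational, below**: `u/v ≤ (a + b√2)/2^e ↔ ¬(0 < (u2^e − va) − vb·√2)`.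
[cite: AaronsonAmbainis2014, proof of Thm. 23 (p. 14)] -/
theorem div_le_sqrtTwo_div_iff (a b : ℤ) (e u : ℕ) {v : ℕ} (hv : 0 < v) :
    (u : ℝ) / v ≤ ((a : ℝ) + Real.sqrt 2 * b) / 2 ^ e ↔
      posSqrtTwoTest ((u : ℤ) * 2 ^ e - (v : ℤ) * a) (-((v : ℤ) * b)) = false := by
  rw [← Bool.not_eq_true, posSqrtTwoTest_iff, div_le_div_iff₀ (by exact_mod_cast hv) (by positivity), not_lt]
  push_cast
  constructor <;> intro h <;> nlinarith [h]

/-- **The output test `E[p_ρ] ≥ 1/2`** as an integer sign condition on the pair sums. [cite: AaronsonAmbainis2014, proof of Thm. 23 (p. 14), Cor. 22] -/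
theorem half_le_boolAvg_nodePoly_iff :
    (1 : ℝ) / 2 ≤ boolAvg (evalBool (ClassicalSimulation.nodePoly (acceptPoly F x) ρ)) ↔
      posSqrtTwoTest (2 ^ (hCount (accGates F x) + 1 + K2 F x) - 2 * (2 * pairSum F x (tA F x) ρ i))
        (-(2 * pairSum F x (tB F x) ρ i)) = false := by
  rw [boolAvg_nodePoly_eq F x ρ i, ← Bool.not_eq_true, posSqrtTwoTest_iff,
    div_le_div_iff₀ (by norm_num) (by positivity), not_lt]
  push_cast
  constructor <;> intro h <;> nlinarith [h]

/-- **The halting test `Vr[p_ρ] ≤ u/v`** as an integer sign condition. [cite: AaronsonAmbainis2014, proof of Thm. 23 (p. 14), Thm. 21] -/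
theorem boolVariance_nodePoly_le_iff (u : ℕ) {v : ℕ} (hv : 0 < v) :
    boolVariance (ClassicalSimulation.nodePoly (acceptPoly F x) ρ) ≤ u / v ↔
      posSqrtTwoTest ((v : ℤ) * varA F x ρ i - (u : ℤ) * 2 ^ D2 F x) ((v : ℤ) * varB F x ρ i) = false := by
  rw [boolVariance_nodePoly_eq F x ρ i]
  exact sqrtTwo_div_le_div_iff (varA F x ρ i) (varB F x ρ i) (D2 F x) u hv

/-- **The query test `u/v ≤ Inf_i[p_ρ]`** as an integer sign condition. [cite: AaronsonAmbainis2014, proof of Thm. 23 (p. 14), Thm. 21] -/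
theorem div_le_influence_nodePoly_iff (u : ℕ) {v : ℕ} (hv : 0 < v) :
    (u : ℝ) / v ≤ influence i (ClassicalSimulation.nodePoly (acceptPoly F x) ρ) ↔
      posSqrtTwoTest ((u : ℤ) * 2 ^ D2 F x - (v : ℤ) * infA F x ρ i) (-((v : ℤ) * infB F x ρ i)) = false := by
  rw [influence_nodePoly_eq F x ρ i]
  exact div_le_sqrtTwo_div_iff (infA F x ρ i) (infB F x ρ i) (D2 F x) u hv

end Node

end Literature.Computability.QuantumComplexity

end
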